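import Summits.AtomisticToContinuum.HydrodynamicLimit.Theorems.TwoClocksEquilibriumShearWindowLD
import Summits.AtomisticToContinuum.HydrodynamicLimit.Theorems.TwoClocksEquilibriumShearWindowLDAllWindows
import Summits.AtomisticToContinuum.HydrodynamicLimit.Theorems.TwoClocksEquilibriumShearWindowLDNormalForms

/-!
# `EquilibriumShearWindowLD`: the window moment as a function of the test function — linearity,
# Cauchy–Schwarz, small test functions, all windows per test function
# (route TwoClocks, stmt-AtomisticToContinuum-14446)

Helper file (`--supports` stmt-AtomisticToContinuum-14446). The item
`TwoClocks.EquilibriumShearWindowLD` asks, for EVERY continuous test function `φ : 𝕋³ → ℝ`, for a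
tilt range `β₀ = β₀(φ) > 0` such that for `|β| ≤ β₀` and every `ε > 0` the window exponential moment
`M_N(β, τ; φ) = ∫ exp(β ∑ᵢ w⁻¹∫₀ʷ φ(xᵢ(r)) vᵢ⁰(r) vᵢ¹(r) dr) dG_N`, `w = τ(N+1)^{-1/3}`, is
`≤ exp(ε(N+1))` eventually in `N` for some window parameter `τ`. This file provides the tools for
the dependence on `φ` (consumed by `TwoClocksEquilibriumShearWindowLDDenseClass.lean`: the good test
functions form a linear subspace, and a sup-norm-uniform bound on a dense class gives the item):

* `shearWindowSum_add`, `shearWindowSum_const_mul` — the window functional `W(φ)` is LINEAR in `φ`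
  along good orbits (interval integrability `intervalIntegrable_shear_orbit`: the integrand is
  time-measurable and bounded by `‖φ‖_∞ · 2E(z)`, energy conservation);
* `shearWindowMoment_add_le` — Cauchy–Schwarz: `M_N(β, τ; φ + ψ) ≤ M_N(2β, τ; φ)^{1/2} M_N(2β, τ; ψ)^{1/2}`;
* `shearWindowMoment_le_of_abs_le` — a SMALL test function costs little: if `|χ| ≤ δ` then
  `M_N(β, τ; χ) ≤ (e^{|β|δ} (1 - 4|β|δθ₀)^{-3/2})^{N+1}` for every window and every `N`
  (`|χ(x) v⁰v¹| ≤ δ(1 + |v|²)` and the a priori Gaussian bound `lintegral_exp_window_sum_le`);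
* `shearWindowMoment_allWindows_of_one` — the per-test-function form of the all-windows upgrade
  (`TwoClocksEquilibriumShearWindowLDAllWindows`): a bound `exp(A(N+1))` at ONE window `τ₁` plus the
  a priori bound give `exp((A+η)(N+1))` at ALL windows `τ ≥ τ₀(η)`, with the same threshold in `N`;
* `one_sub_rpow_neg_three_halves_le` — `(1 - x)^{-3/2} ≤ e^{3x}` on `[0, 1/2]`, which makes the
  Gaussian constant of `shearWindowMoment_le_of_abs_le` at most `exp(|β|δ(1 + 12θ₀))`.

Nothing dynamical is proved here: the item stays open.

References: S. Olla, S. R. S. Varadhan, H.-T. Yau, Comm. Math. Phys. 155 (1993) 523, §2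
(exponential-moment currency, Hölder bookkeeping in the tilt); H. Spohn, *Large Scale Dynamics of
Interacting Particles* (1991), Part I §2.3.

prover-pitem-stmt-AtomisticToContinuum-14446-c3-0.
-/

noncomputable section

open MeasureTheory Real Set
open scoped ENNReal

namespace Summit.AtomisticToContinuum.HydrodynamicLimit.Theorems

open Literature.Analysis.FluidPDE Literature.MathematicalPhysics.KineticTheory
open Summit.AtomisticToContinuum.HydrodynamicLimit.Theses.TwoClocks

/-! ### Linearity of the window functional in the test function (pathwise, on the good set) -/

/-- Along a good orbit the shear integrand `r ↦ φ(xᵢ(r)) vᵢ⁰(r) vᵢ¹(r)` of a continuous `φ` is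
interval integrable on every interval: it is measurable in time
(`IsHardSphereTrajectory.measurable_torus`) and bounded by `‖φ‖_∞ · 2E(z)` (energy conservation
`HardSphereFlow.configEnergy_flow`). [folklore] -/
theorem intervalIntegrable_shear_orbit {ε : ℝ} {n : ℕ}
    (Φ : HardSphereFlow (Torus.geometry (Fin 3)) ε n) {z : Config n (Fin 3) T3} (hz : z ∈ Φ.good)
    {φ : T3 → ℝ} (hφ : Continuous φ) (i : Fin n) (a b : ℝ) :
    IntervalIntegrable (fun r => φ (Φ.flow r z i).1 * ((Φ.flow r z i).2 0 * (Φ.flow r z i).2 1))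
      volume a b := by
  obtain ⟨C, hC⟩ := isCompact_univ.exists_bound_of_continuousOn (hφ.continuousOn (s := univ))
  have hF : Continuous fun y : T3 × V3 => φ y.1 * (y.2 0 * y.2 1) := by fun_prop
  have hγ : Measurable fun t => Φ.flow t z := (Φ.isTrajectory z hz).measurable_torus
  have hm : Measurable fun r => φ (Φ.flow r z i).1 * ((Φ.flow r z i).2 0 * (Φ.flow r z i).2 1) :=
    hF.measurable.comp ((measurable_pi_apply i).comp hγ)
  refine (intervalIntegrable_const (c := C * (2 * configEnergy z))).mono_fun' hm.aestronglyMeasurable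
    (ae_of_all _ fun r => ?_)
  dsimp only
  rw [Real.norm_eq_abs, abs_mul]
  have hφr : |φ (Φ.flow r z i).1| ≤ C := by
    simpa [Real.norm_eq_abs] using hC (Φ.flow r z i).1 (mem_univ _)
  have hC0 : 0 ≤ C := (abs_nonneg _).trans hφr
  have hv : |(Φ.flow r z i).2 0 * (Φ.flow r z i).2 1| ≤ ‖(Φ.flow r z i).2‖ ^ 2 := by
    have h0 : |(Φ.flow r z i).2 0| ≤ ‖(Φ.flow r z i).2‖ := by
      simpa [Real.norm_eq_abs] using PiLp.norm_apply_le (Φ.flow r z i).2 0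
    have h1 : |(Φ.flow r z i).2 1| ≤ ‖(Φ.flow r z i).2‖ := by
      simpa [Real.norm_eq_abs] using PiLp.norm_apply_le (Φ.flow r z i).2 1
    rw [abs_mul, sq]
    exact mul_le_mul h0 h1 (abs_nonneg _) (norm_nonneg _)
  have hE : ‖(Φ.flow r z i).2‖ ^ 2 ≤ 2 * configEnergy z :=
    (norm_vel_sq_le_two_mul_configEnergy _ i).trans_eq (by rw [Φ.configEnergy_flow hz r])
  exact mul_le_mul hφr (hv.trans hE) (abs_nonneg _) hC0

/-- **The window functional is additive in the test function** (on the good set):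
`W(φ + ψ)(z) = W(φ)(z) + W(ψ)(z)`. [folklore] -/
theorem shearWindowSum_add {ε : ℝ} {n : ℕ}
    (Φ : HardSphereFlow (Torus.geometry (Fin 3)) ε n) {z : Config n (Fin 3) T3} (hz : z ∈ Φ.good)
    {φ ψ : T3 → ℝ} (hφ : Continuous φ) (hψ : Continuous ψ) (w : ℝ) :
    ∑ i, w⁻¹ * ∫ r in (0 : ℝ)..w,
        (φ (Φ.flow r z i).1 + ψ (Φ.flow r z i).1) * ((Φ.flow r z i).2 0 * (Φ.flow r z i).2 1) =
      (∑ i, w⁻¹ * ∫ r in (0 : ℝ)..w, φ (Φ.flow r z i).1 * ((Φ.flow r z i).2 0 * (Φ.flow r z i).2 1)) +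
        ∑ i, w⁻¹ * ∫ r in (0 : ℝ)..w, ψ (Φ.flow r z i).1 * ((Φ.flow r z i).2 0 * (Φ.flow r z i).2 1) := by
  rw [← Finset.sum_add_distrib]
  refine Finset.sum_congr rfl fun i _ => ?_
  rw [← mul_add, ← intervalIntegral.integral_add (intervalIntegrable_shear_orbit Φ hz hφ i 0 w)
    (intervalIntegrable_shear_orbit Φ hz hψ i 0 w)]
  congr 1
  refine intervalIntegral.integral_congr fun r _ => ?_
  simp only [add_mul]

/-- **The window functional is homogeneous in the test function**: `W(cφ)(z) = c W(φ)(z)` for every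
`z` (linearity of the interval integral; no integrability needed). [folklore] -/
theorem shearWindowSum_const_mul {ε : ℝ} {n : ℕ}
    (Φ : HardSphereFlow (Torus.geometry (Fin 3)) ε n) (φ : T3 → ℝ) (c w : ℝ)
    (z : Config n (Fin 3) T3) :
    ∑ i, w⁻¹ * ∫ r in (0 : ℝ)..w,
        c * φ (Φ.flow r z i).1 * ((Φ.flow r z i).2 0 * (Φ.flow r z i).2 1) =
      c * ∑ i, w⁻¹ * ∫ r in (0 : ℝ)..w,
        φ (Φ.flow r z i).1 * ((Φ.flow r z i).2 0 * (Φ.flow r z i).2 1) := by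
  rw [Finset.mul_sum]
  refine Finset.sum_congr rfl fun i _ => ?_
  have h1 : (∫ r in (0 : ℝ)..w, c * φ (Φ.flow r z i).1 * ((Φ.flow r z i).2 0 * (Φ.flow r z i).2 1)) =
      ∫ r in (0 : ℝ)..w, c * (φ (Φ.flow r z i).1 * ((Φ.flow r z i).2 0 * (Φ.flow r z i).2 1)) :=
    intervalIntegral.integral_congr fun r _ => by simp only [mul_assoc]
  rw [h1, intervalIntegral.integral_const_mul]
  ring

/-! ### Cauchy–Schwarz in the test function -/

/-- **Cauchy–Schwarz in the test function.** Under the global Gibbs law at rest, for continuous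
`φ, ψ`, every tilt `β`, window `w` and `N`:
`∫ exp(β W(φ + ψ)) dG_N ≤ (∫ exp(2β W(φ)) dG_N)^{1/2} (∫ exp(2β W(ψ)) dG_N)^{1/2}`
(`W(φ + ψ) = W(φ) + W(ψ)` on the good set, which carries `G_N`; then Hölder with exponents `2, 2`).
[folklore] -/
theorem shearWindowMoment_add_le (σ a₀ θ₀ : ℝ) (N : ℕ)
    (Φ : HardSphereFlow (Torus.geometry (Fin 3)) (hsDiameter σ N) (N + 1))
    {φ ψ : T3 → ℝ} (hφ : Continuous φ) (hψ : Continuous ψ) (β w : ℝ) :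
    ∫⁻ z, ENNReal.ofReal (Real.exp (β * ∑ i : Fin (N + 1), w⁻¹ * ∫ r in (0 : ℝ)..w,
        (φ (Φ.flow r z i).1 + ψ (Φ.flow r z i).1) * ((Φ.flow r z i).2 0 * (Φ.flow r z i).2 1)))
        ∂(localGibbsLaw σ (fun _ => a₀) (fun _ => 0) (fun _ => θ₀) N Φ) ≤
      (∫⁻ z, ENNReal.ofReal (Real.exp ((2 * β) * ∑ i : Fin (N + 1), w⁻¹ * ∫ r in (0 : ℝ)..w,
          φ (Φ.flow r z i).1 * ((Φ.flow r z i).2 0 * (Φ.flow r z i).2 1)))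
          ∂(localGibbsLaw σ (fun _ => a₀) (fun _ => 0) (fun _ => θ₀) N Φ)) ^ (1 / 2 : ℝ) *
        (∫⁻ z, ENNReal.ofReal (Real.exp ((2 * β) * ∑ i : Fin (N + 1), w⁻¹ * ∫ r in (0 : ℝ)..w,
          ψ (Φ.flow r z i).1 * ((Φ.flow r z i).2 0 * (Φ.flow r z i).2 1)))
          ∂(localGibbsLaw σ (fun _ => a₀) (fun _ => 0) (fun _ => θ₀) N Φ)) ^ (1 / 2 : ℝ) := by
  set μ := localGibbsLaw σ (fun _ => a₀) (fun _ => 0) (fun _ => θ₀) N Φ with hμ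
  set f : Config (N + 1) (Fin 3) T3 → ℝ≥0∞ := fun z => ENNReal.ofReal (Real.exp (β *
    ∑ i : Fin (N + 1), w⁻¹ * ∫ r in (0 : ℝ)..w,
      φ (Φ.flow r z i).1 * ((Φ.flow r z i).2 0 * (Φ.flow r z i).2 1))) with hf
  set g : Config (N + 1) (Fin 3) T3 → ℝ≥0∞ := fun z => ENNReal.ofReal (Real.exp (β *
    ∑ i : Fin (N + 1), w⁻¹ * ∫ r in (0 : ℝ)..w,
      ψ (Φ.flow r z i).1 * ((Φ.flow r z i).2 0 * (Φ.flow r z i).2 1))) with hg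
  have hfm : AEMeasurable f μ :=
    (Real.measurable_exp.comp_aemeasurable
      ((aemeasurable_shearWindowSum σ a₀ θ₀ N Φ hφ w).const_mul β)).ennreal_ofReal
  have hgm : AEMeasurable g μ :=
    (Real.measurable_exp.comp_aemeasurable
      ((aemeasurable_shearWindowSum σ a₀ θ₀ N Φ hψ w).const_mul β)).ennreal_ofReal
  -- on the good set the integrand factorises
  have hae : ∀ᵐ z ∂μ, ENNReal.ofReal (Real.exp (β * ∑ i : Fin (N + 1), w⁻¹ * ∫ r in (0 : ℝ)..w,
      (φ (Φ.flow r z i).1 + ψ (Φ.flow r z i).1) * ((Φ.flow r z i).2 0 * (Φ.flow r z i).2 1))) =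
        (f * g) z := by
    filter_upwards [ae_mem_good_localGibbsLaw σ (fun _ => a₀) (fun _ => 0) (fun _ => θ₀) N Φ]
      with z hz
    rw [Pi.mul_apply, hf, hg, ← ENNReal.ofReal_mul (Real.exp_pos _).le, ← Real.exp_add,
      shearWindowSum_add Φ hz hφ hψ w, mul_add]
  rw [lintegral_congr_ae hae]
  have hH := ENNReal.lintegral_mul_le_Lp_mul_Lq μ Real.HolderConjugate.two_two hfm hgm
  refine hH.trans_eq ?_
  simp only [hf, hg, ofReal_exp_rpow, ← mul_assoc]

/-! ### A small test function costs little -/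

/-- **Exponential moments of the window functional of a SMALL test function.** Under the global Gibbs
law at rest (`a₀, θ₀ > 0`, `σ ≤ 1/2`), for a continuous `χ` with `|χ| ≤ δ` and a tilt with
`4|β|δθ₀ < 1`: `∫ exp(β W(χ)) dG_N ≤ (e^{|β|δ} (1 - 4|β|δθ₀)^{-3/2})^{N+1}` for every window `w > 0`
and every `N` (`|χ(x) v⁰ v¹| ≤ δ(1 + |v|²)`, then the a priori Gaussian bound
`lintegral_exp_window_sum_le`). The rate `|β|δ + (3/2) log(1/(1 - 4|β|δθ₀))` vanishes with `δ`.
[folklore] -/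
theorem shearWindowMoment_le_of_abs_le {a₀ θ₀ : ℝ} (ha : 0 < a₀) (hθ : 0 < θ₀) {σ : ℝ}
    (hσ2 : σ ≤ 1 / 2) (N : ℕ)
    (Φ : HardSphereFlow (Torus.geometry (Fin 3)) (hsDiameter σ N) (N + 1))
    {χ : T3 → ℝ} {δ : ℝ} (hδ : ∀ x, |χ x| ≤ δ) {β : ℝ} (hβ : 4 * |β| * δ * θ₀ < 1)
    {w : ℝ} (hw : 0 < w) :
    ∫⁻ z, ENNReal.ofReal (Real.exp (β * ∑ i : Fin (N + 1), w⁻¹ * ∫ r in (0 : ℝ)..w,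
        χ (Φ.flow r z i).1 * ((Φ.flow r z i).2 0 * (Φ.flow r z i).2 1)))
        ∂(localGibbsLaw σ (fun _ => a₀) (fun _ => 0) (fun _ => θ₀) N Φ) ≤
      ENNReal.ofReal ((Real.exp (|β| * δ) * (1 - 4 * |β| * δ * θ₀) ^ (-(3 : ℝ) / 2)) ^ (N + 1)) := by
  have hC : ∀ y : T3 × V3, |χ y.1 * (y.2 0 * y.2 1)| ≤ δ * (1 + ‖y.2‖ ^ 2) := by
    intro y
    rw [abs_mul]
    exact mul_le_mul (hδ y.1) (abs_vel_zero_mul_vel_one_le y.2) (abs_nonneg _)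
      ((abs_nonneg _).trans (hδ y.1))
  have h := lintegral_exp_window_sum_le (a₀ := fun _ => a₀) (θ₀ := fun _ => θ₀)
    (u₀ := fun _ => (0 : V3)) continuous_const continuous_const continuous_const (fun _ => ha)
    (fun _ => hθ) hσ2 N Φ (F := fun y : T3 × V3 => χ y.1 * (y.2 0 * y.2 1)) hC (Θ := θ₀) (U := 0)
    (fun _ => le_rfl) (fun _ => by simp) hβ hw
  refine h.trans_eq ?_
  congr 2
  simp

/-! ### All windows from one window, per test function -/

/-- **One good window gives all long windows (per test function).** Under the global Gibbs law at
rest, fix a continuous `φ`, a tilt `β`, an a priori constant `c` with `M_N(β, τ) ≤ exp(c(N+1))` for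
all `τ > 0` and all `N` (`equilibriumShearWindowLD_apriori`), and a window `τ₁` with
`M_N(β, τ₁) ≤ exp(A(N+1))` for `N ≥ N₀` (`A ≥ 0`). Then for every `η > 0` there is `τ₀` with
`M_N(β, τ) ≤ exp((A + η)(N+1))` for ALL `τ ≥ τ₀` and `N ≥ N₀`: write `τ = kτ₁ + r`, `k ≥ m`,
`0 ≤ r < τ₁`, `m ≥ c⁺/η`, and use `shearWindowMoment_nat_mul_le` /
`shearWindowMoment_le_of_nat_mul_add`. [folklore] -/
theorem shearWindowMoment_allWindows_of_one (σ a₀ θ₀ : ℝ)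
    (Φ : (N : ℕ) → HardSphereFlow (Torus.geometry (Fin 3)) (hsDiameter σ N) (N + 1))
    {φ : T3 → ℝ} (hφ : Continuous φ) {β c : ℝ}
    (hc : ∀ τ : ℝ, 0 < τ → ∀ N : ℕ,
      ∫⁻ z, ENNReal.ofReal (Real.exp (β * ∑ i : Fin (N + 1),
          (τ * ((N : ℝ) + 1) ^ (-(1 / 3 : ℝ)))⁻¹ *
            ∫ r in (0 : ℝ)..(τ * ((N : ℝ) + 1) ^ (-(1 / 3 : ℝ))),
              φ ((Φ N).flow r z i).1 * (((Φ N).flow r z i).2 0 * ((Φ N).flow r z i).2 1)))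
          ∂(localGibbsLaw σ (fun _ => a₀) (fun _ => 0) (fun _ => θ₀) N (Φ N)) ≤
        ENNReal.ofReal (Real.exp (c * ((N : ℝ) + 1))))
    {τ₁ A : ℝ} (hτ₁ : 0 < τ₁) (hA0 : 0 ≤ A) {N₀ : ℕ}
    (hA : ∀ N : ℕ, N₀ ≤ N →
      ∫⁻ z, ENNReal.ofReal (Real.exp (β * ∑ i : Fin (N + 1),
          (τ₁ * ((N : ℝ) + 1) ^ (-(1 / 3 : ℝ)))⁻¹ *
            ∫ r in (0 : ℝ)..(τ₁ * ((N : ℝ) + 1) ^ (-(1 / 3 : ℝ))),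
              φ ((Φ N).flow r z i).1 * (((Φ N).flow r z i).2 0 * ((Φ N).flow r z i).2 1)))
          ∂(localGibbsLaw σ (fun _ => a₀) (fun _ => 0) (fun _ => θ₀) N (Φ N)) ≤
        ENNReal.ofReal (Real.exp (A * ((N : ℝ) + 1))))
    {η : ℝ} (hη : 0 < η) :
    ∃ τ₀ : ℝ, 0 < τ₀ ∧ ∀ τ : ℝ, τ₀ ≤ τ → ∀ N : ℕ, N₀ ≤ N →
      ∫⁻ z, ENNReal.ofReal (Real.exp (β * ∑ i : Fin (N + 1),
          (τ * ((N : ℝ) + 1) ^ (-(1 / 3 : ℝ)))⁻¹ *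
            ∫ r in (0 : ℝ)..(τ * ((N : ℝ) + 1) ^ (-(1 / 3 : ℝ))),
              φ ((Φ N).flow r z i).1 * (((Φ N).flow r z i).2 0 * ((Φ N).flow r z i).2 1)))
          ∂(localGibbsLaw σ (fun _ => a₀) (fun _ => 0) (fun _ => θ₀) N (Φ N)) ≤
        ENNReal.ofReal (Real.exp ((A + η) * ((N : ℝ) + 1))) := by
  -- `τ₀ := m τ₁` with `m ≥ c⁺ / η`, `m ≥ 1`
  set cp : ℝ := max c 0 with hcp
  have hcp0 : 0 ≤ cp := le_max_right _ _
  set m : ℕ := ⌈cp / η⌉₊ + 1 with hm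
  have hm1 : (1 : ℝ) ≤ m := by
    rw [hm]; push_cast; linarith [Nat.cast_nonneg (α := ℝ) ⌈cp / η⌉₊]
  have hmpos : (0 : ℝ) < m := one_pos.trans_le hm1
  have hmc : cp / η ≤ m := by
    rw [hm]; push_cast
    exact (Nat.le_ceil _).trans (le_add_of_nonneg_right zero_le_one)
  have hcm : cp / m ≤ η := by
    rw [div_le_iff₀ hmpos]
    rw [div_le_iff₀ hη] at hmc
    linarith
  refine ⟨(m : ℝ) * τ₁, by positivity, fun τ hτ N hNN => ?_⟩
  have hτpos : 0 < τ := (mul_pos hmpos hτ₁).trans_le hτ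
  -- `τ = k τ₁ + r`, `k = ⌊τ/τ₁⌋ ≥ m ≥ 1`, `0 ≤ r < τ₁`
  set k : ℕ := ⌊τ / τ₁⌋₊ with hk
  have hq0 : 0 ≤ τ / τ₁ := (div_pos hτpos hτ₁).le
  have hkle : (k : ℝ) ≤ τ / τ₁ := Nat.floor_le hq0
  have hklt : τ / τ₁ < (k : ℝ) + 1 := Nat.lt_floor_add_one _
  have hmk : m ≤ k := Nat.le_floor (by rwa [le_div_iff₀ hτ₁])
  have hk1 : 1 ≤ k := le_trans (by exact_mod_cast hm1 : 1 ≤ m) hmk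
  have hkm : (m : ℝ) ≤ k := by exact_mod_cast hmk
  set r : ℝ := τ - (k : ℝ) * τ₁ with hr
  have hr0 : 0 ≤ r := by
    rw [hr, sub_nonneg]; rwa [le_div_iff₀ hτ₁] at hkle
  have hrτ₁ : r < τ₁ := by
    rw [hr, sub_lt_iff_lt_add]; rw [div_lt_iff₀ hτ₁] at hklt; linarith
  have hτeq : τ = (k : ℝ) * τ₁ + r := by rw [hr]; ring
  have hAN := hA N hNN
  have hN1 : (0 : ℝ) < (N : ℝ) + 1 := by positivity
  rcases hr0.eq_or_lt with hr00 | hrpos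
  · -- `r = 0`: `τ = k τ₁`
    have hτk : τ = (k : ℝ) * τ₁ := by rw [hτeq, ← hr00, add_zero]
    rw [hτk]
    refine (shearWindowMoment_nat_mul_le σ a₀ θ₀ N (Φ N) φ hφ β hτ₁ k hk1).trans (hAN.trans ?_)
    exact ENNReal.ofReal_le_ofReal (Real.exp_le_exp.2 (by nlinarith))
  · -- `r > 0`: subadditivity step with the a priori bound at window `r`
    have hCr := (hc r hrpos N).trans (ENNReal.ofReal_le_ofReal (Real.exp_le_exp.2
      (mul_le_mul_of_nonneg_right (le_max_left c 0) hN1.le)))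
    rw [hτeq]
    refine (shearWindowMoment_le_of_nat_mul_add σ a₀ θ₀ N (Φ N) hφ β hτ₁ hrpos hk1 hAN hCr).trans ?_
    refine ENNReal.ofReal_le_ofReal (Real.exp_le_exp.2 ?_)
    have hτ' : 0 < (k : ℝ) * τ₁ + r := by rw [← hτeq]; exact hτpos
    have ha1 : (k : ℝ) * τ₁ / ((k : ℝ) * τ₁ + r) ≤ 1 := by
      rw [div_le_one hτ']; linarith
    have hbm : r / ((k : ℝ) * τ₁ + r) ≤ 1 / m := by
      rw [div_le_div_iff₀ hτ' hmpos, one_mul]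
      nlinarith
    have h1 : (k : ℝ) * τ₁ / ((k : ℝ) * τ₁ + r) * (A * ((N : ℝ) + 1)) ≤ A * ((N : ℝ) + 1) :=
      mul_le_of_le_one_left (by positivity) ha1
    have h2 : r / ((k : ℝ) * τ₁ + r) * (cp * ((N : ℝ) + 1)) ≤ η * ((N : ℝ) + 1) := by
      calc r / ((k : ℝ) * τ₁ + r) * (cp * ((N : ℝ) + 1))
          ≤ 1 / m * (cp * ((N : ℝ) + 1)) := mul_le_mul_of_nonneg_right hbm (by positivity)
        _ = cp / m * ((N : ℝ) + 1) := by ring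
        _ ≤ η * ((N : ℝ) + 1) := mul_le_mul_of_nonneg_right hcm hN1.le
    linarith

/-! ### An elementary inequality for the Gaussian constant -/

/-- `(1 - x)^{-3/2} ≤ exp(3x)` for `0 ≤ x ≤ 1/2` (`(1-x)⁻¹ ≤ 1 + 2x ≤ e^{2x}`). [folklore] -/
theorem one_sub_rpow_neg_three_halves_le {x : ℝ} (hx0 : 0 ≤ x) (hx : x ≤ 1 / 2) :
    (1 - x) ^ (-(3 : ℝ) / 2) ≤ Real.exp (3 * x) := by
  have h1x : 0 < 1 - x := by linarith
  have hinv : (1 - x)⁻¹ ≤ Real.exp (2 * x) := by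
    rw [inv_le_iff_one_le_mul₀ h1x]
    have h12 : 1 + 2 * x ≤ Real.exp (2 * x) := by linarith [Real.add_one_le_exp (2 * x)]
    nlinarith [Real.exp_pos (2 * x)]
  calc (1 - x) ^ (-(3 : ℝ) / 2) = ((1 - x)⁻¹) ^ ((3 : ℝ) / 2) := by
        rw [Real.inv_rpow h1x.le, ← Real.rpow_neg h1x.le]
        norm_num
    _ ≤ (Real.exp (2 * x)) ^ ((3 : ℝ) / 2) :=
        Real.rpow_le_rpow (inv_nonneg.2 h1x.le) hinv (by norm_num)
    _ = Real.exp (3 * x) := by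
        rw [← Real.exp_mul]
        ring_nf

/-! ### Convexity in the test function: convex combinations cost no tilt -/

/-- **The window moment is convex in the test function.** Under the global Gibbs law at rest, for
continuous `φ, ψ`, weights `p, q ≥ 0` with `p + q = 1`, every tilt `β`, window `w` and `N`:
`M(β; pφ + qψ) ≤ p M(β; φ) + q M(β; ψ)` (linearity of `W` on the good set, convexity of `exp`). In
contrast with sums (`shearWindowMoment_add_le`: tilt `2β`), convex combinations cost NO tilt: for
fixed `(β, w, N)` and bound `B`, the set of test functions with `M(β; ·) ≤ B` is convex (and it is
symmetric under `φ ↦ -φ` once both signs of `β` are controlled). [folklore] -/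
theorem shearWindowMoment_convex_le (σ a₀ θ₀ : ℝ) (N : ℕ)
    (Φ : HardSphereFlow (Torus.geometry (Fin 3)) (hsDiameter σ N) (N + 1))
    {φ ψ : T3 → ℝ} (hφ : Continuous φ) (hψ : Continuous ψ) {p q : ℝ} (hp : 0 ≤ p) (hq : 0 ≤ q)
    (hpq : p + q = 1) (β w : ℝ) :
    ∫⁻ z, ENNReal.ofReal (Real.exp (β * ∑ i : Fin (N + 1), w⁻¹ * ∫ r in (0 : ℝ)..w,
        (p * φ (Φ.flow r z i).1 + q * ψ (Φ.flow r z i).1) * ((Φ.flow r z i).2 0 * (Φ.flow r z i).2 1)))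
        ∂(localGibbsLaw σ (fun _ => a₀) (fun _ => 0) (fun _ => θ₀) N Φ) ≤
      ENNReal.ofReal p * ∫⁻ z, ENNReal.ofReal (Real.exp (β * ∑ i : Fin (N + 1), w⁻¹ *
          ∫ r in (0 : ℝ)..w, φ (Φ.flow r z i).1 * ((Φ.flow r z i).2 0 * (Φ.flow r z i).2 1)))
          ∂(localGibbsLaw σ (fun _ => a₀) (fun _ => 0) (fun _ => θ₀) N Φ) +
        ENNReal.ofReal q * ∫⁻ z, ENNReal.ofReal (Real.exp (β * ∑ i : Fin (N + 1), w⁻¹ *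
          ∫ r in (0 : ℝ)..w, ψ (Φ.flow r z i).1 * ((Φ.flow r z i).2 0 * (Φ.flow r z i).2 1)))
          ∂(localGibbsLaw σ (fun _ => a₀) (fun _ => 0) (fun _ => θ₀) N Φ) := by
  set μ := localGibbsLaw σ (fun _ => a₀) (fun _ => 0) (fun _ => θ₀) N Φ with hμ
  have hφm : AEMeasurable (fun z => ENNReal.ofReal (Real.exp (β * ∑ i : Fin (N + 1), w⁻¹ *
      ∫ r in (0 : ℝ)..w, φ (Φ.flow r z i).1 * ((Φ.flow r z i).2 0 * (Φ.flow r z i).2 1)))) μ :=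
    (Real.measurable_exp.comp_aemeasurable
      ((aemeasurable_shearWindowSum σ a₀ θ₀ N Φ hφ w).const_mul β)).ennreal_ofReal
  have hψm : AEMeasurable (fun z => ENNReal.ofReal (Real.exp (β * ∑ i : Fin (N + 1), w⁻¹ *
      ∫ r in (0 : ℝ)..w, ψ (Φ.flow r z i).1 * ((Φ.flow r z i).2 0 * (Φ.flow r z i).2 1)))) μ :=
    (Real.measurable_exp.comp_aemeasurable
      ((aemeasurable_shearWindowSum σ a₀ θ₀ N Φ hψ w).const_mul β)).ennreal_ofReal
  have hpφ : Continuous fun x => p * φ x := continuous_const.mul hφ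
  have hqψ : Continuous fun x => q * ψ x := continuous_const.mul hψ
  -- pointwise on the good set: linearity of `W` and convexity of `exp`
  have hae : ∀ᵐ z ∂μ, ENNReal.ofReal (Real.exp (β * ∑ i : Fin (N + 1), w⁻¹ * ∫ r in (0 : ℝ)..w,
      (p * φ (Φ.flow r z i).1 + q * ψ (Φ.flow r z i).1) * ((Φ.flow r z i).2 0 * (Φ.flow r z i).2 1))) ≤
      ENNReal.ofReal p * ENNReal.ofReal (Real.exp (β * ∑ i : Fin (N + 1), w⁻¹ *
          ∫ r in (0 : ℝ)..w, φ (Φ.flow r z i).1 * ((Φ.flow r z i).2 0 * (Φ.flow r z i).2 1))) +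
        ENNReal.ofReal q * ENNReal.ofReal (Real.exp (β * ∑ i : Fin (N + 1), w⁻¹ *
          ∫ r in (0 : ℝ)..w, ψ (Φ.flow r z i).1 * ((Φ.flow r z i).2 0 * (Φ.flow r z i).2 1))) := by
    filter_upwards [ae_mem_good_localGibbsLaw σ (fun _ => a₀) (fun _ => 0) (fun _ => θ₀) N Φ]
      with z hz
    rw [shearWindowSum_add Φ hz hpφ hqψ w, shearWindowSum_const_mul, shearWindowSum_const_mul,
      ← ENNReal.ofReal_mul hp, ← ENNReal.ofReal_mul hq,
      ← ENNReal.ofReal_add (mul_nonneg hp (Real.exp_pos _).le) (mul_nonneg hq (Real.exp_pos _).le)]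
    refine ENNReal.ofReal_le_ofReal ?_
    have h := convexOn_exp.2 (Set.mem_univ (β * ∑ i : Fin (N + 1), w⁻¹ *
        ∫ r in (0 : ℝ)..w, φ (Φ.flow r z i).1 * ((Φ.flow r z i).2 0 * (Φ.flow r z i).2 1)))
      (Set.mem_univ (β * ∑ i : Fin (N + 1), w⁻¹ *
        ∫ r in (0 : ℝ)..w, ψ (Φ.flow r z i).1 * ((Φ.flow r z i).2 0 * (Φ.flow r z i).2 1))) hp hq hpq
    simp only [smul_eq_mul] at h
    refine le_of_eq_of_le ?_ h
    congr 1
    ring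
  refine (lintegral_mono_ae hae).trans_eq ?_
  rw [lintegral_add_left' (hφm.const_mul _), lintegral_const_mul'' _ hφm, lintegral_const_mul'' _ hψm]

end Summit.AtomisticToContinuum.HydrodynamicLimit.Theorems

end
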